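import Literature.Geometry.Lorentzian.KerrConvergence
import Literature.Geometry.Lorentzian.CauchyDevelopment
import HarnessLib

/-!
# Near-Kerr leaves of a Cauchy development (summit `FinalStateConjecture`)

The **parametrised leaf predicate** `CauchyDevelopment.IsNearKerrLeaf 𝒟 k ε N M a S` wanted by
route `QuietWindowCapture` of the summit `FinalStateConjecture` (work item `defn-IsNearKerrLeaf`):
"`S ⊆ 𝒟` is an `(ε, k)`-near-Kerr leaf with `N` holes of masses `Mᵢ` and spins `aᵢ`" — a
finite-time copy of the late-time vocabulary of `KerrConvergence` (`ModelBackground`,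
`Spacetime.truncDeviationCk`, `Spacetime.deviationCk`, `FinalStateDecomposition`) in which ONE
hypersurface `S`, rather than a whole late region, is charted and certified:

* `N` **hole charts** `Ψᵢ` on the boosted Kerr *star regions* `{rᵢ > Mᵢ}` around straight
  world-lines `(Λᵢ, cᵢ)` (`starBackground`: rest-frame Kerr–Schild time `t*ᵢ` and radius `rᵢ`,
  boosted Kerr–Schild form), smooth open embeddings of the layers
  `Lᵢ = {−1 < t*ᵢ < 1, rᵢ < Rᵢ + 1}` into `J⁺(ι X)`, `ε`-close in `Cᵏ` to boosted Kerr on the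
  truncated slab `{t*ᵢ = 0, rᵢ ≤ Rᵢ}` (`truncDeviationCk … k Rᵢ 0 ≤ ε`), `0 < Mᵢ`, `|aᵢ| ≤ Mᵢ`;
* ONE **flat chart** `Ψ₀` on `U₀ ⊇ {t₀ > −1, rᵢ > ρᵢ ∀ i}` with the Minkowski form and the
  HYPERBOLOIDAL time `t₀ = x⁰ − √(1 + |x̲|²)` (`hypBackground`), a smooth open embedding of
  `L₀ = {−1 < t₀ < 1}` into `J⁺(ι X)`, `ε`-close in `Cᵏ` to `η` on the hyperboloidal leaf
  `{t₀ = 0}` (`deviationCk … k 0 ≤ ε`);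
* overlap radii `0 < ρᵢ < Rᵢ`, both overlap annuli charted by the other chart, pairwise
  disjoint near zones `Ψᵢ(Lᵢ ∩ {rᵢ ≤ Rᵢ})`;
* `S = Ψ₀({t₀ = 0}) ∪ ⋃ᵢ Ψᵢ({t*ᵢ = 0, rᵢ ≤ Rᵢ})`, upper layers
  `W = Ψ₀({0 < t₀ < 1}) ∪ ⋃ᵢ Ψᵢ({0 < t*ᵢ < 1, rᵢ ≤ Rᵢ}) ⊆ I⁺(S)`, and the barrier clause
  `exteriorOf 𝒟 W ∖ W ⊆ J⁻(S)` — the finite-time copy of the covering device of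
  `FinalStateDecomposition.diff_subset_causalPast` / the summit's `HasExhaustiveCharts`.

The body of `IsNearKerrLeaf` is, VERBATIM up to unfolding the three definitions
`starBackground`, `hypBackground`, `CauchyDevelopment.exteriorOf` of this file, the common
block inlined three times in the route's items `QuietLeaves` (stmt-FinalStateConjecture-10114),
`Capture` (-10115) and `GenericLegs` (-10116) of
`Summits/FinalStateConjecture/FinalStateConjecture/Theses/QuietWindowCapture.lean`, so that the
items restate over it with identical meaning (`Iff.rfl`; checked in the session's scratch file,
which Literature cannot import). In particular the equational binders `r = …`, `B = …`,
`B₀ = …`, `L = …`, `W = …`, `L₀ = …`, `W₀ = …` of the filed text are kept as they are.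

## Also here

* `CauchyDevelopment.exteriorOf 𝒟 U = J⁺(ι X) ∩ I⁻(U)` — the port, announced in the porting
  guide of `CauchyDevelopment.lean`, of `Development.exteriorOf` (`FinalState.lean`, stated over
  the uninhabited `Development` carrier) to the repaired carrier `CauchyDevelopment`; verbatim the
  body of the summit-side auxiliary `Summit.FinalStateConjecture.exteriorOf` (which Literature
  cannot import, CONVENTIONS §2), hence definitionally equal to it.
* sanity API: unfolding lemmas for the two backgrounds, `boostedKerrExterior ≤ star domain`
  (`M ≤ r₊`), the hyperboloidal time lies below `x⁰ − 1`, monotonicity of `IsNearKerrLeaf` in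
  `(k, ε)` (`supCkENorm_mono_right`), positivity of the masses, and `S ⊆ J⁺(ι X)`.

## Sources

Consequence-form ("there is a chart in which the `Cᵏ` deviation is small") vocabulary:
Dafermos–Holzegel–Rodnianski–Taylor arXiv:2104.08222, §1, as everywhere in `KerrConvergence`;
Kerr-star time `t*` and the slabs `{t* = τ}`: Dafermos–Rodnianski, Clay lectures
(arXiv:0811.0354), §5.1; the exterior region `J⁺(ι X) ∩ I⁻(U)`: Dafermos–Luk arXiv:1710.01722,
Conjecture 1 ("black hole exterior region `J⁻(𝓘⁺)`"); hyperboloidal leaves `{x⁰ − √(1+|x̲|²) = τ}`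
of Minkowski space: folklore (the unit hyperboloids translated in time; cf. the hyperboloidal
foliations of Dafermos–Rodnianski–Shlapentokh-Rothman arXiv:1402.7034, §3.3). The predicate
`IsNearKerrLeaf` itself has NO printed source: it is posited by the route (planner
`planner-plancard-FinalStateConjecture-FinalSt-7d35149b-0`, 2026-08-15) and recorded here so that
the three items can be restated readably; nothing is asserted about it.

## Mathlib

No Lorentzian geometry, Kerr metric or causal structure in Mathlib; used are
`TopologicalSpace.Opens`, `Topology.IsOpenEmbedding`, `ContMDiffOn`, `Set` algebra, `ℝ≥0∞`.

## Not here

No relation between `IsNearKerrLeaf` and `FinalStateDecomposition` is proved (a late enough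
leaf of an honest decomposition is a near-Kerr leaf only after re-charting the flat region in
hyperboloidal time — a statement with analytic content, left to the routes).
-/

noncomputable section

open Set TopologicalSpace Filter Topology
open scoped Manifold ContDiff Topology ENNReal

universe u

namespace Literature.Geometry.Lorentzian

/-! ### The exterior region determined by a charted set, over the repaired carrier -/

namespace CauchyDevelopment

section Exterior

variable {n : ℕ} {X : Type u} [TopologicalSpace X] [ChartedSpace (EuclideanSpace ℝ (Fin n)) X]
  [IsManifold (𝓡 n) ∞ X] [ConnectedSpace X] {D : InitialDataSet (𝓡 n) X}

/-- The **exterior region determined by a charted set `U`** of the Cauchy development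
`𝒟 = (M, g, τ, ι, ν)`: `J⁺(ι X) ∩ I⁻(U)`, the events to the causal future of the data
hypersurface from which a timelike signal reaches `U`. Verbatim the body of
`Development.exteriorOf` (`FinalState.lean`), ported to the repaired carrier `CauchyDevelopment`
as announced in the porting guide of `CauchyDevelopment.lean`, and verbatim (hence
definitionally) equal to the summit-side `Summit.FinalStateConjecture.exteriorOf`. For `U` the
late image of converging asymptotic charts this is the `𝓘⁺`-free stand-in for
`J⁻(𝓘⁺) ∩ J⁺(Σ)`. [cite: DafermosLuk2017, Conjecture 1] -/
def exteriorOf (𝒟 : CauchyDevelopment D) (U : Set 𝒟.carrier) : Set 𝒟.carrier :=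
  𝒟.metric.causalFuture 𝒟.timeOrientation (range 𝒟.embed) ∩
    𝒟.metric.chronologicalPast 𝒟.timeOrientation U

/-- Unfolding lemma for `CauchyDevelopment.exteriorOf`. [folklore] -/
theorem mem_exteriorOf_iff (𝒟 : CauchyDevelopment D) (U : Set 𝒟.carrier) (p : 𝒟.carrier) :
    p ∈ 𝒟.exteriorOf U ↔ p ∈ 𝒟.metric.causalFuture 𝒟.timeOrientation (range 𝒟.embed) ∧
      p ∈ 𝒟.metric.chronologicalPast 𝒟.timeOrientation U :=
  Iff.rfl

/-- The exterior region determined by `U` lies to the causal future of the data hypersurface.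
[folklore] -/
theorem exteriorOf_subset_causalFuture (𝒟 : CauchyDevelopment D) (U : Set 𝒟.carrier) :
    𝒟.exteriorOf U ⊆ 𝒟.metric.causalFuture 𝒟.timeOrientation (range 𝒟.embed) :=
  inter_subset_left

/-- The exterior region determined by `U` lies in the chronological past of `U`. [folklore] -/
theorem exteriorOf_subset_chronologicalPast (𝒟 : CauchyDevelopment D) (U : Set 𝒟.carrier) :
    𝒟.exteriorOf U ⊆ 𝒟.metric.chronologicalPast 𝒟.timeOrientation U :=
  inter_subset_right

/-- The exterior region is monotone in the charted set (`I⁻` is monotone; O'Neill 1983, Ch. 14,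
p. 402, time-dually). [folklore] -/
theorem exteriorOf_mono (𝒟 : CauchyDevelopment D) {U V : Set 𝒟.carrier} (h : U ⊆ V) :
    𝒟.exteriorOf U ⊆ 𝒟.exteriorOf V :=
  inter_subset_inter_right _ (LorentzianMetric.chronologicalFuture_mono h)

end Exterior

end CauchyDevelopment

/-! ### The two model backgrounds of a near-Kerr leaf -/

/-- The **boosted Kerr star background** `starBackground Λ c M a r`: coordinate domain the
boosted, translated Kerr STAR REGION `{x | Λ⁻¹(x − c) ∈ Kerr.region a M} = {r_{M,a}(Λ⁻¹(x − c)) >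
max M 0}` (inner radius `M`, a horizon-penetrating neighbourhood of the exterior `{r > r₊}` since
`r₋ ≤ M ≤ r₊`), reference form the boosted Kerr–Schild form `boostedKerrBilin Λ c M a`, time
function the rest-frame Kerr–Schild (Kerr-star) time `t*(x) = (Λ⁻¹(x − c))⁰`, and radius
function the parameter `r` — in `IsNearKerrLeaf` always instantiated with the boosted Kerr–Schild
radius `x ↦ r_{a}(Λ⁻¹(x − c))` (kept as a parameter so that the filed items are the verbatim
inlining). Compare `boostedKerrBackground` (same form, time and radius on the smaller domain
`{r > r₊}`). Kerr-star time and the slabs `{t* = τ}`: Dafermos–Rodnianski, arXiv:0811.0354,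
§5.1. [cite: DafermosRodnianski2008, §5.1] -/
def starBackground (Λ : lorentzGroup) (c : E4) (M a : ℝ) (r : E4 → ℝ) : ModelBackground :=
  ⟨⟨poincareInv Λ c ⁻¹' (Kerr.region a M : Set E4),
      (Kerr.region a M).isOpen.preimage (continuous_poincareInv Λ c)⟩,
    boostedKerrBilin Λ c M a, fun x => poincareInv Λ c x 0, r⟩

section StarBackground

variable (Λ : lorentzGroup) (c : E4) (M a : ℝ) (r : E4 → ℝ)

/-- The domain of the star background is the boosted star region (DR arXiv:0811.0354, §5.1).
[cite: DafermosRodnianski2008, §5.1] -/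
@[simp]
theorem coe_starBackground_domain :
    ((starBackground Λ c M a r).domain : Set E4) = poincareInv Λ c ⁻¹' (Kerr.region a M : Set E4) :=
  rfl

/-- Membership in the domain of the star background: `Λ⁻¹(x − c) ∈ Kerr.region a M`, i.e.
`max M 0 < r_a(Λ⁻¹(x − c))` (DR arXiv:0811.0354, §5.1). [cite: DafermosRodnianski2008, §5.1] -/
@[simp]
theorem mem_starBackground_domain {x : E4} :
    x ∈ (starBackground Λ c M a r).domain ↔ poincareInv Λ c x ∈ Kerr.region a M :=
  Iff.rfl

/-- The reference form of the star background is the boosted Kerr–Schild form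
(Kerr–Schild 1965; DR arXiv:0811.0354, §5.1). [cite: DafermosRodnianski2008, §5.1] -/
@[simp]
theorem starBackground_bilin : (starBackground Λ c M a r).bilin = boostedKerrBilin Λ c M a :=
  rfl

/-- The time function of the star background is the rest-frame Kerr-star time
`(Λ⁻¹(x − c))⁰` (DR arXiv:0811.0354, §5.1). [cite: DafermosRodnianski2008, §5.1] -/
@[simp]
theorem starBackground_time (x : E4) : (starBackground Λ c M a r).time x = poincareInv Λ c x 0 :=
  rfl

/-- The radius function of the star background is the parameter `r`
(DR arXiv:0811.0354, §5.1). [cite: DafermosRodnianski2008, §5.1] -/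
@[simp]
theorem starBackground_radius : (starBackground Λ c M a r).radius = r :=
  rfl

/-- The star region contains the exterior: `boostedKerrExterior Λ c M a = {r > r₊}` lies in the
domain `{r > M}` of the star background, because `M ≤ r₊ = M + √(M² − a²)` (DR arXiv:0811.0354,
§5.1: the Kerr-star chart is regular across `𝓗⁺`; cf. `Kerr.M_le_rPlus` of
`KerrSeparatedPotentialBounds`, not imported here). [cite: DafermosRodnianski2008, §5.1] -/
theorem boostedKerrExterior_le_starBackground_domain :
    boostedKerrExterior Λ c M a ≤ (starBackground Λ c M a r).domain :=
  fun _ hx ↦ Kerr.region_mono a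
    (show M ≤ Kerr.rPlus M a from le_add_of_nonneg_right (Real.sqrt_nonneg _)) hx

/-- With the boosted Kerr–Schild radius, the star background has the same form, time and radius
functions as `boostedKerrBackground` (only the domain is larger). Klainerman, §4 (folklore
boosted Kerr). [folklore] -/
theorem starBackground_time_eq_boostedKerrBackground_time :
    (starBackground Λ c M a fun x ↦ Kerr.radius a (poincareInv Λ c x)).time =
        (boostedKerrBackground Λ c M a).time ∧
      (starBackground Λ c M a fun x ↦ Kerr.radius a (poincareInv Λ c x)).radius =
        (boostedKerrBackground Λ c M a).radius ∧
      (starBackground Λ c M a fun x ↦ Kerr.radius a (poincareInv Λ c x)).bilin =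
        (boostedKerrBackground Λ c M a).bilin :=
  ⟨rfl, rfl, rfl⟩

end StarBackground

/-- The **hyperboloidal flat background** `hypBackground U₀` on the open set `U₀ ⊆ E4`: the
Minkowski form `η`, the HYPERBOLOIDAL time `t₀(x) = x⁰ − √(1 + |x̲|²)` — whose level sets
`{t₀ = τ}` are the unit spacelike hyperboloids `(x⁰ − τ)² − |x̲|² = 1`, `x⁰ > τ`, asymptotic to
the light cones and reaching future null infinity — and radius `|x̲|`. Compare
`Minkowski.backgroundOn U₀` (same domain, form and radius, time `x⁰`). Standard hyperboloidal
foliation of Minkowski space (cf. Dafermos–Rodnianski–Shlapentokh-Rothman arXiv:1402.7034,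
§3.3, hyperboloidal hypersurfaces terminating at `𝓘⁺`). [folklore] -/
def hypBackground (U₀ : Opens E4) : ModelBackground :=
  ⟨U₀, fun _ => Minkowski.bilin, fun x => x 0 - Real.sqrt (1 + E4.spatialNorm x ^ 2),
    E4.spatialNorm⟩

section HypBackground

variable (U₀ : Opens E4)

/-- The domain of the hyperboloidal flat background is `U₀`. [folklore] -/
@[simp]
theorem hypBackground_domain : (hypBackground U₀).domain = U₀ :=
  rfl

/-- The reference form of the hyperboloidal flat background is `η`. [folklore] -/
@[simp]
theorem hypBackground_bilin (x : E4) : (hypBackground U₀).bilin x = Minkowski.bilin :=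
  rfl

/-- The time function of the hyperboloidal flat background is `x⁰ − √(1 + |x̲|²)`. [folklore] -/
@[simp]
theorem hypBackground_time (x : E4) :
    (hypBackground U₀).time x = x 0 - Real.sqrt (1 + E4.spatialNorm x ^ 2) :=
  rfl

/-- The radius function of the hyperboloidal flat background is `|x̲|`. [folklore] -/
@[simp]
theorem hypBackground_radius : (hypBackground U₀).radius = E4.spatialNorm :=
  rfl

/-- The hyperboloidal flat background differs from `Minkowski.backgroundOn U₀` only in its time
function. [folklore] -/
theorem hypBackground_eq_backgroundOn :
    (hypBackground U₀).domain = (Minkowski.backgroundOn U₀).domain ∧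
      (hypBackground U₀).bilin = (Minkowski.backgroundOn U₀).bilin ∧
      (hypBackground U₀).radius = (Minkowski.backgroundOn U₀).radius :=
  ⟨rfl, rfl, rfl⟩

/-- The hyperboloidal time lies at least one unit below the Cartesian time:
`x⁰ − √(1 + |x̲|²) ≤ x⁰ − 1` (the hyperboloid `{t₀ = τ}` has its tip at `x⁰ = τ + 1`).
[folklore] -/
theorem hypBackground_time_le (x : E4) : (hypBackground U₀).time x ≤ x 0 - 1 := by
  rw [hypBackground_time]
  have h : Real.sqrt 1 ≤ Real.sqrt (1 + E4.spatialNorm x ^ 2) :=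
    Real.sqrt_le_sqrt (by nlinarith [sq_nonneg (E4.spatialNorm x)])
  rw [Real.sqrt_one] at h
  linarith

/-- On the hyperboloidal leaf `{t₀ = τ}` the Cartesian time is `x⁰ = τ + √(1 + |x̲|²) ≥ τ + 1`.
[folklore] -/
theorem le_time_of_mem_hypBackground_timeSlab {τ : ℝ} {x : (hypBackground U₀).domain}
    (hx : x ∈ (hypBackground U₀).timeSlab τ) : τ + 1 ≤ x.1 0 := by
  rw [ModelBackground.mem_timeSlab] at hx
  have h := hypBackground_time_le U₀ x.1
  rw [hx] at h
  linarith

end HypBackground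

/-! ### Near-Kerr leaves -/

namespace CauchyDevelopment

variable {X : Type u} [TopologicalSpace X] [ChartedSpace E3 X] [IsManifold (𝓡 3) ∞ X]
  [ConnectedSpace X] {D : InitialDataSet (𝓡 3) X}

/-- **`S` is an `(ε, k)`-near-Kerr leaf of the Cauchy development `𝒟` with `N` holes of masses
`M` and spins `a`** (route-posited notion of route `QuietWindowCapture`, summit
`FinalStateConjecture`; verbatim the block inlined in its items `QuietLeaves`/`Capture`/
`GenericLegs`, see the module docstring): there are truncation and overlap radii `Rᵢ`, `ρᵢ`,
motions `(Λᵢ, cᵢ)`, the boosted Kerr–Schild radii `rᵢ`, the `N` star backgrounds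
`Bᵢ = starBackground Λᵢ cᵢ Mᵢ aᵢ rᵢ`, a flat domain `U₀` with its hyperboloidal background
`B₀ = hypBackground U₀`, hole charts `Ψᵢ : Bᵢ.domain → 𝒟` and a flat chart `Ψ₀ : U₀ → 𝒟`, the
layers `Lᵢ = {−1 < t*ᵢ < 1, rᵢ < Rᵢ + 1}`, `L₀ = {−1 < t₀ < 1}` and upper layers
`Wᵢ = {0 < t*ᵢ < 1, rᵢ ≤ Rᵢ}`, `W₀ = {0 < t₀ < 1}`, such that: `0 < Mᵢ`, `|aᵢ| ≤ Mᵢ`,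
`0 < ρᵢ < Rᵢ`; `U₀ ⊇ {t₀ > −1, rᵢ > ρᵢ ∀ i}`; every chart is smooth on its layer, an open
embedding of it, with image in `J⁺(ι X)`; the `Cᵏ` deviation of `Ψᵢ^* g` from boosted Kerr on
the truncated slab `{t*ᵢ = 0, rᵢ ≤ Rᵢ}` and of `Ψ₀^* g` from `η` on the hyperboloidal leaf
`{t₀ = 0}` are `≤ ε`; the near zones `Ψᵢ(Lᵢ ∩ {rᵢ ≤ Rᵢ})` are pairwise disjoint; the overlap
annuli are mutually charted, `Ψᵢ({t*ᵢ = 0, ρᵢ < rᵢ ≤ Rᵢ}) ⊆ Ψ₀(L₀)` and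
`Ψ₀({t₀ = 0, ρᵢ < rᵢ < Rᵢ}) ⊆ Ψᵢ(Lᵢ)`; `S = Ψ₀({t₀ = 0}) ∪ ⋃ᵢ Ψᵢ({t*ᵢ = 0, rᵢ ≤ Rᵢ})`; the
upper layers `W = Ψ₀(W₀) ∪ ⋃ᵢ Ψᵢ(Wᵢ)` lie in `I⁺(S)`; and the barrier clause
`exteriorOf 𝒟 W ∖ W ⊆ J⁻(S)` holds (finite-time copy of the covering device of
`FinalStateDecomposition`). For an MGHD `𝒟 : VacuumCauchyDevelopment D` write
`𝒟.IsNearKerrLeaf k ε N M a S` (dot notation through `toCauchyDevelopment`). Here `ε : ℝ≥0∞`,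
the codomain of `deviationCk` (`ε = ∞` makes the two closeness clauses vacuous). Chart /
deviation vocabulary in consequence form: DHRT arXiv:2104.08222, §1.
[cite: DafermosHolzegelRodnianskiTaylor2021, §1] -/
def IsNearKerrLeaf (𝒟 : CauchyDevelopment D) (k : ℕ) (ε : ℝ≥0∞) (N : ℕ) (M a : Fin N → ℝ)
    (S : Set 𝒟.carrier) : Prop :=
  ∃ (R ρ : Fin N → ℝ) (mo : Fin N → lorentzGroup × E4) (r : Fin N → E4 → ℝ)
    (B : Fin N → ModelBackground) (U₀ : Opens E4) (B₀ : ModelBackground)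
    (Ψ : ∀ i, (B i).domain → 𝒟.carrier) (Ψ₀ : B₀.domain → 𝒟.carrier)
    (L W : ∀ i, Set (B i).domain) (L₀ W₀ : Set B₀.domain),
    (∀ i, r i = fun x => Kerr.radius (a i) (poincareInv (mo i).1 (mo i).2 x)) ∧
    (∀ i, B i = starBackground (mo i).1 (mo i).2 (M i) (a i) (r i)) ∧
    B₀ = hypBackground U₀ ∧
    (∀ i, L i = {x | -1 < (B i).time x.1 ∧ (B i).time x.1 < 1 ∧ (B i).radius x.1 < R i + 1} ∧
      W i = {x | 0 < (B i).time x.1 ∧ (B i).time x.1 < 1 ∧ (B i).radius x.1 ≤ R i}) ∧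
    L₀ = {x | -1 < B₀.time x.1 ∧ B₀.time x.1 < 1} ∧
    W₀ = {x | 0 < B₀.time x.1 ∧ B₀.time x.1 < 1} ∧
    (∀ i, 0 < M i ∧ |a i| ≤ M i ∧ 0 < ρ i ∧ ρ i < R i) ∧
    {x : E4 | -1 < x 0 - Real.sqrt (1 + E4.spatialNorm x ^ 2) ∧ ∀ i, ρ i < r i x} ⊆
      (U₀ : Set E4) ∧
    (∀ i, ContMDiffOn 𝓘(ℝ, E4) (𝓡 4) ∞ (Ψ i) (L i) ∧ IsOpenEmbedding ((L i).restrict (Ψ i)) ∧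
      Ψ i '' L i ⊆ 𝒟.metric.causalFuture 𝒟.timeOrientation (range 𝒟.embed)) ∧
    ContMDiffOn 𝓘(ℝ, E4) (𝓡 4) ∞ Ψ₀ L₀ ∧ IsOpenEmbedding (L₀.restrict Ψ₀) ∧
    Ψ₀ '' L₀ ⊆ 𝒟.metric.causalFuture 𝒟.timeOrientation (range 𝒟.embed) ∧
    (∀ i, 𝒟.toSpacetime.truncDeviationCk (B i) (Ψ i) k (R i) 0 ≤ ε) ∧
    𝒟.toSpacetime.deviationCk B₀ Ψ₀ k 0 ≤ ε ∧
    Pairwise (Function.onFun Disjoint fun i => Ψ i '' {x | x ∈ L i ∧ (B i).radius x.1 ≤ R i}) ∧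
    (∀ i, Ψ i '' {x | (B i).time x.1 = 0 ∧ ρ i < (B i).radius x.1 ∧ (B i).radius x.1 ≤ R i} ⊆
      Ψ₀ '' L₀) ∧
    (∀ i, Ψ₀ '' {x | B₀.time x.1 = 0 ∧ ρ i < r i x.1 ∧ r i x.1 < R i} ⊆ Ψ i '' L i) ∧
    S = Ψ₀ '' B₀.timeSlab 0 ∪ ⋃ i, Ψ i '' (B i).truncTimeSlab (R i) 0 ∧
    Ψ₀ '' W₀ ∪ ⋃ i, Ψ i '' W i ⊆ 𝒟.metric.chronologicalFuture 𝒟.timeOrientation S ∧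
    𝒟.exteriorOf (Ψ₀ '' W₀ ∪ ⋃ i, Ψ i '' W i) \ (Ψ₀ '' W₀ ∪ ⋃ i, Ψ i '' W i) ⊆
      𝒟.metric.causalPast 𝒟.timeOrientation S

namespace IsNearKerrLeaf

variable {𝒟 : CauchyDevelopment D} {k k' : ℕ} {ε ε' : ℝ≥0∞} {N : ℕ} {M a : Fin N → ℝ}
  {S : Set 𝒟.carrier}

/-- The holes of a near-Kerr leaf have positive masses and `|aᵢ| ≤ Mᵢ` (the parameter clause).
[cite: DafermosHolzegelRodnianskiTaylor2021, §1] -/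
theorem mass_pos_and_abs_spin_le (h : 𝒟.IsNearKerrLeaf k ε N M a S) (i : Fin N) :
    0 < M i ∧ |a i| ≤ M i := by
  obtain ⟨_, _, _, _, _, _, _, _, _, _, _, _, _, -, -, -, -, -, -, hpar, -⟩ := h
  exact ⟨(hpar i).1, (hpar i).2.1⟩

/-- **Monotonicity in `(k, ε)`.** An `(ε, k')`-near-Kerr leaf is an `(ε', k)`-near-Kerr leaf for
`k ≤ k'`, `ε ≤ ε'`, with the same charts: all `Cᵏ` sup norms are monotone in `k`
(`supCkENorm_mono_right`). DHRT arXiv:2104.08222, §1 (closeness with loss of derivatives).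
[cite: DafermosHolzegelRodnianskiTaylor2021, §1] -/
theorem mono (h : 𝒟.IsNearKerrLeaf k' ε N M a S) (hk : k ≤ k') (hε : ε ≤ ε') :
    𝒟.IsNearKerrLeaf k ε' N M a S := by
  obtain ⟨R, ρ, mo, r, B, U₀, B₀, Ψ, Ψ₀, L, W, L₀, W₀, hr, hB, hB₀, hLW, hL₀, hW₀, hpar, hU₀, hΨ,
    hΨ₀, hΨ₀e, hΨ₀J, hdev, hdev₀, hrest⟩ := h
  exact ⟨R, ρ, mo, r, B, U₀, B₀, Ψ, Ψ₀, L, W, L₀, W₀, hr, hB, hB₀, hLW, hL₀, hW₀, hpar, hU₀, hΨ,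
    hΨ₀, hΨ₀e, hΨ₀J, fun i ↦ ((supCkENorm_mono_right _ hk _).trans (hdev i)).trans hε,
    ((supCkENorm_mono_right _ hk _).trans hdev₀).trans hε, hrest⟩

/-- A near-Kerr leaf lies to the causal future of the data hypersurface: each piece of `S` is a
chart image of part of the chart's layer, and the layers are mapped into `J⁺(ι X)`.
[cite: DafermosHolzegelRodnianskiTaylor2021, §1] -/
theorem subset_causalFuture (h : 𝒟.IsNearKerrLeaf k ε N M a S) :
    S ⊆ 𝒟.metric.causalFuture 𝒟.timeOrientation (range 𝒟.embed) := by
  obtain ⟨R, ρ, mo, r, B, U₀, B₀, Ψ, Ψ₀, L, W, L₀, W₀, -, -, -, hLW, hL₀, -, -, -, hΨ, -, -, hΨ₀J,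
    -, -, -, -, -, hS, -, -⟩ := h
  rw [hS]
  refine union_subset ((image_mono fun x hx ↦ ?_).trans hΨ₀J)
    (iUnion_subset fun i ↦ (image_mono fun x hx ↦ ?_).trans (hΨ i).2.2)
  · rw [ModelBackground.mem_timeSlab] at hx
    rw [hL₀, mem_setOf_eq, hx]
    norm_num
  · rw [ModelBackground.mem_truncTimeSlab] at hx
    rw [(hLW i).1, mem_setOf_eq, hx.1]
    exact ⟨by norm_num, by norm_num, by linarith [hx.2]⟩

/-- The upper layers of a near-Kerr leaf lie in its chronological future and the leaf carries the
barrier clause; in particular every point of the exterior region determined by the upper layers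
is in an upper layer or in `J⁻(S)` (restatement of the last two clauses).
[cite: DafermosHolzegelRodnianskiTaylor2021, §1] -/
theorem exists_upper (h : 𝒟.IsNearKerrLeaf k ε N M a S) :
    ∃ W : Set 𝒟.carrier, W ⊆ 𝒟.metric.chronologicalFuture 𝒟.timeOrientation S ∧
      𝒟.exteriorOf W ⊆ W ∪ 𝒟.metric.causalPast 𝒟.timeOrientation S := by
  obtain ⟨R, ρ, mo, r, B, U₀, B₀, Ψ, Ψ₀, L, W, L₀, W₀, -, -, -, -, -, -, -, -, -, -, -, -, -, -, -,
    -, -, -, hWI, hbar⟩ := h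
  exact ⟨_, hWI, fun p hp ↦ (em (p ∈ Ψ₀ '' W₀ ∪ ⋃ i, Ψ i '' W i)).elim Or.inl
    fun hn ↦ Or.inr (hbar ⟨hp, hn⟩)⟩

end IsNearKerrLeaf

end CauchyDevelopment

end Literature.Geometry.Lorentzian

end
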